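import Mathlib
import Summits.NavierStokesRegularity.NavierStokesRegularity.Theorems.TaoLadderRungTwoBreakBlowupRigidityOneFrontLinks
import Summits.NavierStokesRegularity.NavierStokesRegularity.Theses.WakeRatchet
import HarnessLib

/-!
# The three-item FRONT BUNDLE also delivers route WakeRatchet's UNBOUNDED extraction crux `EternalRigidityViscOne`
  (stmt-NavierStokesRegularity-23198) BY NAME — a by-name link of the type-I-free extraction chain of
  `stub_eternalFromBlowup` of K2(1) `TaoLadderRungTwoBreak.BlowupRigidityOne` (stmt-NavierStokesRegularity-20206)

MODEL lattice ODEs only (Tao 2016 §4, §6.4); nothing here is a statement about the Navier–Stokes equations; NO item is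
closed (`--supports stmt-NavierStokesRegularity-20206`): both theorems are CONDITIONAL on the open front bundle.

Route WakeRatchet's crux ⟨23198⟩ `EternalRigidityViscOne := ∀ R ≥ 1, EternalRigidityVisc R 1` asks robust blow-up to
force SOME admissible viscous eternal solution (`IsEternalVisc ε₀ ν̂ α W`, any `ν̂ ≥ 0`) surviving forward at `a = 1`,
WITHOUT `UniformBound`; its thesis predicts «the extraction needs only LOCAL compactness plus the clock — the type-I
envelope is no longer asked». That is what `stub_eternalFromBlowup_of_fronts` (this chain) proves at `ν̂ = 0`:

* `eternalRigidityViscOne_of_fronts` — three-item front bundle (action ceiling; amplitude ceiling `B ν^j`,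
  `(1+ε₀)⁻¹ ≤ ν²`; floor on the self-similar schedule on every shell) for every robust blow-up below threshold ⇒
  `Theses.WakeRatchet.EternalRigidityViscOne` (via the previous hand's `eternalRigidityViscOne_of_stubEternalFromBlowup`);
* `eternalRigidityVisc_one_of_fronts` — the same per spread `R`, as the tree predicate `EternalRigidityVisc R 1`.

HONEST LABEL: conditional; the front bundle is the open (E2) content; nothing is closed; no summit is touched.
-/

noncomputable section

-- the summit and its single sub-problem share the name (CONVENTIONS §1)
set_option linter.dupNamespace false

open Set Filter Topology MeasureTheory

namespace Summit.NavierStokesRegularity.NavierStokesRegularity.Theorems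

namespace BlowupRigidityOne

open Literature.Analysis.FluidPDE Literature.Analysis.FluidPDE.TaoCascade

/-- **FRONT BUNDLE ⇒ WakeRatchet's `EternalRigidityViscOne` (⟨23198⟩) BY NAME**, with `ν̂ = 0`: the conclusion is
LITERALLY the route decl; the hypothesis is the open three-item front bundle attached to every robust blow-up below a
threshold. [cite: Tao2016AveragedNS, §4 Thm. 4.2 (statement shape), §6.4; KochNadirashviliSereginSverak2009, Thm 1.1 ff.; cell vocabulary] -/
theorem eternalRigidityViscOne_of_fronts
    (H : ∀ R : ℝ, 1 ≤ R → ∃ εs : ℝ, 0 < εs ∧ ∀ ε₀ : ℝ, 0 < ε₀ → ε₀ ≤ εs →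
      ∀ (α : (Fin 4 → Fin 4 → Fin 4 → ℤ × ℤ × ℤ → ℝ)) (X₀ : Fin 4 → ℝ),
        InTableClass R α → NoGlobalCascade ε₀ α X₀ →
        ∃ (T A B ν cf κ₂ : ℝ) (X : Fin 4 → ℤ → ℝ → ℝ), 0 < T ∧
          (∀ i n, ContDiffOn ℝ 1 (X i n) (Set.Ico 0 T)) ∧
          (∀ i n t, 0 ≤ t → t < T → derivWithin (X i n) (Set.Ici 0) t = quadTerm ε₀ α X i n t) ∧
          (∀ k : ℤ, IntegrableOn (fun t => ‖shellVec X k t‖) (Ico 0 T) ∧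
            bigLam ε₀ ^ k * (∫ t in Ico 0 T, ‖shellVec X k t‖) ≤ A) ∧
          0 < ν ∧ (1 + ε₀)⁻¹ ≤ ν ^ 2 ∧
          (∀ (j : ℤ) (t : ℝ), 0 ≤ t → t < T → ‖shellVec X j t‖ ≤ B * ν ^ j) ∧
          0 < cf ∧ 0 < κ₂ ∧
          (∀ k : ℕ, ∃ t : ℝ, 0 ≤ t ∧ t < T ∧ cf * (ν ^ 2) ^ k ≤ ‖shellVec X (k : ℤ) t‖ ^ 2 ∧
            (bigLam ε₀ ^ 2 * ν ^ 2) ^ k * (T - t) ^ 2 ≤ κ₂)) :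
    Summit.NavierStokesRegularity.NavierStokesRegularity.Theses.WakeRatchet.EternalRigidityViscOne :=
  eternalRigidityViscOne_of_stubEternalFromBlowup (stub_eternalFromBlowup_of_fronts H)

/-- The same per spread `R`, as the tree predicate `EternalRigidityVisc R 1` (robust blow-up ⇒ an admissible viscous
eternal solution surviving forward at `a = 1`; here inviscid, `ν̂ = 0`).
[cite: Tao2016AveragedNS, §4 Thm. 4.2 (statement shape), §6.4; cell vocabulary (`EternalRigidityVisc`)] -/
theorem eternalRigidityVisc_one_of_fronts
    (H : ∀ R : ℝ, 1 ≤ R → ∃ εs : ℝ, 0 < εs ∧ ∀ ε₀ : ℝ, 0 < ε₀ → ε₀ ≤ εs →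
      ∀ (α : (Fin 4 → Fin 4 → Fin 4 → ℤ × ℤ × ℤ → ℝ)) (X₀ : Fin 4 → ℝ),
        InTableClass R α → NoGlobalCascade ε₀ α X₀ →
        ∃ (T A B ν cf κ₂ : ℝ) (X : Fin 4 → ℤ → ℝ → ℝ), 0 < T ∧
          (∀ i n, ContDiffOn ℝ 1 (X i n) (Set.Ico 0 T)) ∧
          (∀ i n t, 0 ≤ t → t < T → derivWithin (X i n) (Set.Ici 0) t = quadTerm ε₀ α X i n t) ∧
          (∀ k : ℤ, IntegrableOn (fun t => ‖shellVec X k t‖) (Ico 0 T) ∧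
            bigLam ε₀ ^ k * (∫ t in Ico 0 T, ‖shellVec X k t‖) ≤ A) ∧
          0 < ν ∧ (1 + ε₀)⁻¹ ≤ ν ^ 2 ∧
          (∀ (j : ℤ) (t : ℝ), 0 ≤ t → t < T → ‖shellVec X j t‖ ≤ B * ν ^ j) ∧
          0 < cf ∧ 0 < κ₂ ∧
          (∀ k : ℕ, ∃ t : ℝ, 0 ≤ t ∧ t < T ∧ cf * (ν ^ 2) ^ k ≤ ‖shellVec X (k : ℤ) t‖ ^ 2 ∧
            (bigLam ε₀ ^ 2 * ν ^ 2) ^ k * (T - t) ^ 2 ≤ κ₂))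
    {R : ℝ} (hR : 1 ≤ R) : EternalRigidityVisc R 1 :=
  eternalRigidityViscOne_of_fronts H R hR

end BlowupRigidityOne

end Summit.NavierStokesRegularity.NavierStokesRegularity.Theorems

end
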